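import Mathlib
import Literature.Computability.AlgebraicComplexity.MatrixMultiplicationExponent
import Literature.Computability.AlgebraicComplexity.BorderRankCW

/-!
# Slice determinants of `⟨m,m,m⟩` and of the little Coppersmith–Winograd tensor `cw_q`

Topic `Summits/MatrixMultiplication/MatrixMultiplication/Theorems` (supports the aside item
`FarEdgeDescent.LittleCwFlat`; used by `LittleCwNotMatMulDegeneration`).

The **slice-determinant invariant**: contract the third factor of a tensor `t ∈ K^N ⊗ K^N ⊗ K^N`
against a weight vector and take the determinant of the resulting `N × N` matrix.

* `det_matMul_sliceC` — for `⟨m,m,m⟩` (`N = m²`) the contracted matrix is `1 ⊗ₖ Yᵀ`, so its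
  determinant is `det(Y)^m`, an `m`-th power (Landsberg, *Geometry and Complexity Theory* (2017),
  §5.1: the determinantal picture of `1_A`-generic tensors; folklore).
* `det_cw_sliceC_line` — for `cw_q` (`cwTensor`, Conner–Gesmundo–Landsberg–Ventura 2022, eq. (1))
  along the weight line `(1, u, v, 0, …, 0)` the contracted matrix has determinant `-(u² + v²)`
  (two row operations make it lower triangular); along `ℓ(t) = (1, 1+t, i t, 0, …)` this is
  `-(1+2t)`, of `t`-degree `1` (`natDegree_det_cw_sliceC_lineI`).
* `contract_eq_mul` — bookkeeping: the contraction of a transformed tensor `(A ⊗ B ⊗ C) s` is the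
  matrix product `A · S · Bᵀ` with `S` the contraction of `s` against the transformed weights.
* `trailingCoeff_pow'`, `trailingCoeff_X_pow_mul` — trailing coefficients over a domain.
-/

namespace Summit.MatrixMultiplication.MatrixMultiplication.Theorems.LittleCwSliceDeterminants

open Polynomial Matrix Finset
open scoped Kronecker
open Literature.Computability.AlgebraicComplexity

noncomputable section

/-! ## Third-index contractions ("slices") of `⟨m,m,m⟩` and of `cw_q` -/

section Slices

variable {R : Type*} [CommRing R]

/-- Contracting the third index of `⟨k,m,n⟩` against weights `y`:
`∑_c y_c ⟨k,m,n⟩_{a b c} = [a.1 = b.1] · y (b.2, a.2)`. [folklore] -/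
theorem matMul_sliceC_apply (k m n : ℕ) (y : Fin m × Fin n → R) (a : Fin k × Fin n)
    (b : Fin k × Fin m) :
    (∑ c, y c * matMulTensor R k m n a b c) = if a.1 = b.1 then y (b.2, a.2) else 0 := by
  classical
  have key : ∀ c : Fin m × Fin n, y c * matMulTensor R k m n a b c =
      if c = (b.2, a.2) then (if a.1 = b.1 then y (b.2, a.2) else 0) else 0 := by
    intro c
    unfold matMulTensor
    by_cases hc : c = (b.2, a.2)
    · subst hc
      by_cases h : a.1 = b.1 <;> simp [h]
    · have hne : ¬ (a.1 = b.1 ∧ b.2 = c.1 ∧ a.2 = c.2) := by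
        rintro ⟨-, h1, h2⟩
        exact hc (Prod.ext h1.symm h2.symm)
      simp [hc, hne]
  simp_rw [key]
  simp

/-- The third-index contraction of `⟨m,m,m⟩` is the Kronecker product `1 ⊗ₖ Yᵀ`,
`Y_{μν} = y (μ, ν)`. [folklore] -/
theorem matMul_sliceC_eq_kronecker (m : ℕ) (y : Fin m × Fin m → R) :
    (Matrix.of fun a b : Fin m × Fin m => ∑ c, y c * matMulTensor R m m m a b c) =
      (1 : Matrix (Fin m) (Fin m) R) ⊗ₖ (Matrix.of fun ν μ : Fin m => y (μ, ν)) := by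
  ext ⟨a₁, a₂⟩ ⟨b₁, b₂⟩
  rw [Matrix.of_apply, matMul_sliceC_apply, Matrix.kronecker_apply, Matrix.one_apply,
    Matrix.of_apply]
  by_cases h : a₁ = b₁ <;> simp [h]

/-- **Slice determinants of `⟨m,m,m⟩` are `m`-th powers**: `det (∑_c y_c ⟨m,m,m⟩_{··c}) = det(Y)^m`.
[folklore; Landsberg 2017, §5.1] -/
theorem det_matMul_sliceC (m : ℕ) (y : Fin m × Fin m → R) :
    (Matrix.of fun a b : Fin m × Fin m => ∑ c, y c * matMulTensor R m m m a b c).det =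
      (Matrix.of fun ν μ : Fin m => y (μ, ν)).det ^ m := by
  classical
  rw [matMul_sliceC_eq_kronecker, Matrix.det_kronecker, Matrix.det_one, one_pow, one_mul,
    Fintype.card_fin]

/-- Contracting the third index of `cw_q` against weights `ℓ` (closed form). [folklore] -/
theorem cw_sliceC_apply (q : ℕ) (ℓ : Fin (q + 1) → R) (a b : Fin (q + 1)) :
    (∑ c, ℓ c * cwTensor R q a b c) =
      if a = b then (if a = 0 then 0 else ℓ 0)
      else if a = 0 then ℓ b else if b = 0 then ℓ a else 0 := by
  classical
  unfold cwTensor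
  by_cases hab : a = b
  · subst hab
    by_cases ha : a = 0
    · subst ha
      simp
    · simp [ha]
  · by_cases ha : a = 0
    · subst ha
      have hb : b ≠ 0 := fun h => hab h.symm
      have hb' : ¬ (0 : Fin (q + 1)) = b := hab
      simp [hb, hb']
    · by_cases hb : b = 0
      · subst hb
        simp [hab]
      · simp [hab, ha, hb]

set_option maxHeartbeats 400000 in
/-- **`det` of the contracted `cw_q`-matrix along the weight line `ℓ = (1,u,v,0,…,0)` is
`-(u²+v²)`** (`q ≥ 2`): subtracting `u ×` row `1` and `v ×` row `2` from row `0` makes the matrix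
lower triangular with diagonal `(-(u²+v²), 1, …, 1)`. [this file] -/
theorem det_cw_sliceC_line (q : ℕ) (hq : 2 ≤ q) (u v : R) (ℓ : Fin (q + 1) → R)
    (hℓ : ∀ j, ℓ j = if j.val = 0 then 1 else if j.val = 1 then u else if j.val = 2 then v else 0) :
    (Matrix.of fun a b : Fin (q + 1) => ∑ c, ℓ c * cwTensor R q a b c).det = -(u ^ 2 + v ^ 2) := by
  classical
  set W := Matrix.of fun a b : Fin (q + 1) => ∑ c, ℓ c * cwTensor R q a b c with hW
  have hℓ0 : ℓ 0 = 1 := by rw [hℓ]; simp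
  have hWapp : ∀ a b : Fin (q + 1), W a b =
      if a.val = b.val then (if a.val = 0 then 0 else 1)
      else if a.val = 0 then ℓ b else if b.val = 0 then ℓ a else 0 := by
    intro a b
    rw [hW, Matrix.of_apply, cw_sliceC_apply, hℓ0]
    simp only [Fin.ext_iff, Fin.val_zero]
  let i₁ : Fin (q + 1) := ⟨1, by omega⟩
  let i₂ : Fin (q + 1) := ⟨2, by omega⟩
  have h10 : (0 : Fin (q + 1)) ≠ i₁ := by simp [i₁, Fin.ext_iff]
  have h20 : (0 : Fin (q + 1)) ≠ i₂ := by simp [i₂, Fin.ext_iff]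
  set W₁ := W.updateRow 0 (W 0 + (-u) • W i₁) with hW₁
  set W₂ := W₁.updateRow 0 (W₁ 0 + (-v) • W₁ i₂) with hW₂
  have hd₁ : W₁.det = W.det := Matrix.det_updateRow_add_smul_self W h10 (-u)
  have hd₂ : W₂.det = W₁.det := Matrix.det_updateRow_add_smul_self W₁ h20 (-v)
  -- entries of `W₂`
  have hW₁i₂ : W₁ i₂ = W i₂ := Matrix.updateRow_ne h20.symm
  have hent : ∀ a b : Fin (q + 1), W₂ a b =
      if a.val = 0 then W 0 b - u * W i₁ b - v * W i₂ b else W a b := by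
    intro a b
    by_cases ha : a = 0
    · subst ha
      simp only [hW₂, Matrix.updateRow_self, Pi.add_apply, Pi.smul_apply, smul_eq_mul, hW₁i₂,
        Fin.val_zero, if_true]
      simp only [hW₁, Matrix.updateRow_self, Pi.add_apply, Pi.smul_apply, smul_eq_mul]
      ring
    · have ha' : a.val ≠ 0 := fun h => ha (Fin.ext h)
      simp only [hW₂, Matrix.updateRow_ne ha, if_neg ha']
      simp only [hW₁, Matrix.updateRow_ne ha]
  have hi₁ : (i₁ : Fin (q + 1)).val = 1 := rfl
  have hi₂ : (i₂ : Fin (q + 1)).val = 2 := rfl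
  -- `W₂` is lower triangular
  have htri : W₂.BlockTriangular OrderDual.toDual := by
    intro i j hij
    have hij' : i < j := OrderDual.toDual_lt_toDual.mp hij
    have hv : i.val < j.val := hij'
    rw [hent]
    simp only [hWapp, hℓ, hi₁, hi₂, Fin.val_zero]
    split_ifs <;> first | contradiction | omega | ring
  have h00 : W₂ 0 0 = -(u ^ 2 + v ^ 2) := by
    rw [hent]
    simp only [hWapp, hℓ, hi₁, hi₂, Fin.val_zero]
    split_ifs <;> first | contradiction | omega | ring
  have hsucc : ∀ i : Fin q, W₂ i.succ i.succ = 1 := by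
    intro i
    rw [hent]
    have h1 : (i.succ).val ≠ 0 := by simp [Fin.val_succ]
    simp only [hWapp, if_neg h1, if_true]
  rw [← hd₁, ← hd₂, Matrix.det_of_lowerTriangular W₂ htri, Fin.prod_univ_succ, h00]
  simp [hsucc]

end Slices

/-! ## A bookkeeping identity: contraction of a transformed tensor as a matrix product -/

section Contract

variable {L : Type*} [CommRing L]

/-- For `G = (A' ⊗ B' ⊗ C') s` and weights `w`, the third-index contraction
`N_{a'b'} = ∑_{c'} w_{c'} G_{a'b'c'}` is the matrix product `A' · S · B'ᵀ` with
`S_{ab} = ∑_c (∑_{c'} w_{c'} C'_{c'c}) s_{abc}` (source indices reindexed by `e`). [folklore] -/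
theorem contract_eq_mul {ι σ τ : Type*} [Fintype ι] [DecidableEq ι] [Fintype σ] [Fintype τ]
    (e : ι ≃ σ) (A' B' : ι → σ → L) (w : ι → L) (C' : ι → τ → L) (s : σ → σ → τ → L) :
    (Matrix.of fun a' b' : ι =>
        ∑ c', w c' * ∑ a, ∑ b, ∑ c, A' a' a * B' b' b * C' c' c * s a b c) =
      Matrix.of (fun i j => A' i (e j)) *
        (Matrix.of fun a b : σ => ∑ c, (∑ c', w c' * C' c' c) * s a b c).submatrix e e *
        (Matrix.of fun i j => B' i (e j))ᵀ := by
  ext a' b'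
  simp only [Matrix.mul_apply, Matrix.transpose_apply, Matrix.submatrix_apply, Matrix.of_apply]
  -- reindex the two sums over `ι` on the right through `e`
  have step : (∑ x, (∑ z, A' a' (e z) * ∑ c, (∑ c', w c' * C' c' c) * s (e z) (e x) c) *
      B' b' (e x)) = ∑ b, (∑ a, A' a' a * ∑ c, (∑ c', w c' * C' c' c) * s a b c) * B' b' b := by
    rw [← Equiv.sum_comp e]
    refine Finset.sum_congr rfl fun x _ => ?_
    rw [← Equiv.sum_comp e]
  rw [step]
  -- both sides are `∑ a b c c'` of the same monomial
  have lhs : (∑ c', w c' * ∑ a, ∑ b, ∑ c, A' a' a * B' b' b * C' c' c * s a b c) =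
      ∑ a, ∑ b, ∑ c, ∑ c', w c' * (A' a' a * B' b' b * C' c' c * s a b c) := by
    simp only [Finset.mul_sum]
    rw [Finset.sum_comm]
    refine Finset.sum_congr rfl fun a _ => ?_
    rw [Finset.sum_comm]
    refine Finset.sum_congr rfl fun b _ => ?_
    rw [Finset.sum_comm]
  have rhs : (∑ b, (∑ a, A' a' a * ∑ c, (∑ c', w c' * C' c' c) * s a b c) * B' b' b) =
      ∑ a, ∑ b, ∑ c, ∑ c', w c' * (A' a' a * B' b' b * C' c' c * s a b c) := by
    simp only [Finset.mul_sum, Finset.sum_mul]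
    rw [Finset.sum_comm]
    refine Finset.sum_congr rfl fun a _ => Finset.sum_congr rfl fun b _ =>
      Finset.sum_congr rfl fun c _ => Finset.sum_congr rfl fun c' _ => ?_
    ring
  rw [lhs, rhs]

end Contract

/-! ## Trailing coefficients -/

section Trailing

variable {S : Type*} [CommRing S] [NoZeroDivisors S]

/-- Trailing coefficients are multiplicative over a domain: `tc (p^n) = tc(p)^n`. [Mathlib-style
helper; `Polynomial.trailingCoeff_mul`] -/
theorem trailingCoeff_pow' (p : S[X]) (n : ℕ) :
    (p ^ n).trailingCoeff = p.trailingCoeff ^ n := by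
  induction n with
  | zero =>
    nontriviality S
    simp [trailingCoeff]
  | succ n ih => rw [pow_succ, trailingCoeff_mul, ih, pow_succ]

/-- `tc (X^n · p) = tc p`. [Mathlib-style helper] -/
theorem trailingCoeff_X_pow_mul [Nontrivial S] (p : S[X]) (n : ℕ) :
    ((X : S[X]) ^ n * p).trailingCoeff = p.trailingCoeff := by
  have hX : ((X : S[X]) ^ n).trailingCoeff = 1 := by
    rw [trailingCoeff, natTrailingDegree_X_pow, coeff_X_pow_self]
  rw [trailingCoeff_mul, hX, one_mul]

end Trailing

/-! ## The weight line `ℓ(t) = (1, 1+t, i t, 0, …, 0)` over `ℂ[t]` -/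

section Line

/-- Along the line `ℓ(t) = (1, 1+t, i t, 0, …, 0)` the contracted `cw_q`-determinant is
`-(1+2t) = C(-2)·t + C(-1)`. [this file] -/
theorem det_cw_sliceC_lineI (q : ℕ) (hq : 2 ≤ q) (ℓ : Fin (q + 1) → ℂ[X])
    (hℓ : ∀ j, ℓ j = if j.val = 0 then 1 else if j.val = 1 then X + 1
      else if j.val = 2 then C Complex.I * X else 0) :
    (Matrix.of fun a b : Fin (q + 1) => ∑ c, ℓ c * cwTensor ℂ[X] q a b c).det =
      C (-2) * X + C (-1) := by
  rw [det_cw_sliceC_line q hq (X + 1) (C Complex.I * X) ℓ hℓ]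
  have hI : (C Complex.I : ℂ[X]) ^ 2 = -1 := by
    rw [← C_pow, Complex.I_sq, C_neg, C_1]
  have h2 : (C (-2 : ℂ) : ℂ[X]) = -2 := by
    rw [C_neg, show (C (2 : ℂ) : ℂ[X]) = 2 from map_ofNat C 2]
  rw [mul_pow, hI, h2, C_neg, C_1]
  ring

/-- … hence it has `t`-degree exactly `1` (not a multiple of any `m ≥ 2`). [this file] -/
theorem natDegree_det_cw_sliceC_lineI (q : ℕ) (hq : 2 ≤ q) (ℓ : Fin (q + 1) → ℂ[X])
    (hℓ : ∀ j, ℓ j = if j.val = 0 then 1 else if j.val = 1 then X + 1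
      else if j.val = 2 then C Complex.I * X else 0) :
    (Matrix.of fun a b : Fin (q + 1) => ∑ c, ℓ c * cwTensor ℂ[X] q a b c).det.natDegree = 1 := by
  rw [det_cw_sliceC_lineI q hq ℓ hℓ, natDegree_add_C, natDegree_C_mul_X _ (by norm_num)]

end Line

end

end Summit.MatrixMultiplication.MatrixMultiplication.Theorems.LittleCwSliceDeterminants
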